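import Summits.QuantumFields.YangMills.Theorems.BalabanLadderUVSeamRecCeilingsBlockFieldLocality
import Summits.QuantumFields.YangMills.Theorems.BalabanLadderUVSeamRecCeilingsDLRPeelingResponseMoments
import HarnessLib

/-!
# Crux `UVSeamRec` (stmt-QuantumFields-20043), lane B: the (UCR) ⇒ window-cell-law ⇒ doubled-moments chain of DLR peeling with the
# SMALL COLLAR `m ≥ 3`, for EVERY odd block size `b`

Helper file (`--supports stmt-QuantumFields-20043`) of the width-lever seat `ym-20043-ceilings-p2` (lane B, gen 7); sequel of
`…CeilingsBlockFieldLocality` (the true link support `b^k y + [0,4b^k)⁴` of the block-field events and `localBox_window`, `m ≥ 3`) and the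
twin of g6's `…CeilingsDLRPeelingWindowCellLaw` §4 / `…CeilingsDLRPeelingResponseMoments` §2 with the collar condition `𝔟.b ≤ m` replaced by
`3 ≤ m`.

THE POINT.  In g6's chain the collar parameter `m` of the one-box hypothesis (UCR) had to satisfy `𝔟.b ≤ m` (formal chart-box support inside
the collar cube) and `m ≤ 7` (collar cube inside the (RM) torus at the top family-shell level), forcing Bałaban's block size `b ≤ 7` — below
the printed range «L > 11» of [Balaban1987RG1] p. 251.  With the TRUE support of `blockField` (locality of the k-fold averaging,
`BlockFieldLocality.isCylinder_indicator_largeFieldEvent_local`) the first condition becomes `3 ≤ m`, independent of `b`: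
* `torusE_prod_indicator_largeField_le_of_uniformKernelBound_smallCollar` — (UCR_k) with collar `m ≥ 3` ⇒ the hWCL-binder law
  `⟨∏_{γ∈A} 1_{E_γ}∘lift⟩ ≤ ∏ w^{1/(256(2m+4)⁴)}` for every window family, on every torus holding the collar cube (proof = g6's, with the
  local support plugged into the peeling engine `torusE_prod_le_prod_of_kerE_le`);
* `windowCellLaw_of_uniformConditionalRarity_smallCollar` — the same in the letters of the hWCL binder;
* `torusE_exp_two_mul_sum_influence_le_of_uniformConditionalRarity_smallCollar` — doubled joint exponential moments of the influence
  functionals at the (RM) torus from (UCR) at the levels `k ≥ 1`, collar `3 ≤ m ≤ 7`, same constant `2e²·1536·(δ₀ + Σ_k w_k^{1/(16K)})`,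
  `K = 256(2m+4)⁴`.
The (RM) press-buttons and the v8 glue with `3 ≤ m ≤ 7` are the sequel `…CeilingsDLRPeelingSmallCollarGlue`.

HONEST FRAMING.  Reductions (folklore probability: DLR peeling, thinning); the one-box estimate (UCR_k) is the OPEN large-field input (Bałaban's
R-operation currency with Dirichlet data), classically inconsistent for thresholds below the flat-penetration value of the collar cube
(`≈ π⁴/(2(2m+1)⁴)` in block-field units; LEAD 20043 FINDING #50); nothing of E0′; not a gap, not Clay.  References: folklore; T. Bałaban,
Commun. Math. Phys. 122 (1989) 355–392 (intended supplier).
-/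

set_option autoImplicit false

noncomputable section

open MeasureTheory Filter Topology Finset
open Literature.Probability.LatticeModels
open Literature.MathematicalPhysics.QuantumFieldTheory (GaugeConfig wilsonMeasure LatticeRep isProbabilityMeasure_wilsonMeasure
  measurable_torusLift)
open Literature.MathematicalPhysics.QuantumLattice (LGConfig torusLift IsCylinder ymSpecification isProbabilityMeasure_ymSpecification
  integrable_of_abs_le fundamentalLatticeRep)

namespace Summit.QuantumFields.YangMills.Cruxes.UVSeamRec.DLRPeeling

open Summit.QuantumFields.YangMills.Cruxes.OSLegsFromFemtoAndGap.DlrCollarTransfer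
open Summit.QuantumFields.YangMills.Cruxes.UVSeamRec.PolymerData
open Summit.QuantumFields.YangMills.Cruxes.UVSeamRec.TemperedResponse
open Summit.QuantumFields.YangMills.Cruxes.UVSeamRec.BlockFieldLocality
open Summit.QuantumFields.YangMills.Theorems.OddTorusChessboard (Orient)

/-! ## §1 (UCR_k) with collar `m ≥ 3` ⇒ the window cell law on every torus holding the collar cube -/

section Assembly

variable {N : ℕ} [NeZero N] (r : LatticeRep (Matrix.specialUnitaryGroup (Fin N) ℂ))

/-- **THE WINDOW CELL LAW FROM (UCR_k), SMALL COLLAR.**  `SU(N)`, any lattice representation `r`, any `β`; ANY odd block size `𝔟`, collar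
`m ≥ 3`, threshold `ε`, level `k`, odd torus `2L+1` with `(2m+1)b^k + 3 ≤ 2L+1`; a weight `w ∈ [0,1]` with (UCR_k): for every block index `y`,
orientation `μ<ν` and EVERY exterior `η`, `kerE^η_{(b^k(y−m),(2m+1)b^k)}(1_{largeFieldEvent 𝔟 ε (k,y,μ,ν)}) ≤ w`.  Then for every window origin
`o` and every finite family `A` of level-`k` block-plaquettes whose blocks fit in `[o, o+2L+1)⁴`:
`⟨∏_{γ∈A} 1_{largeFieldEvent 𝔟 ε γ}∘lift⟩_{2L+1,β} ≤ ∏_{γ∈A} w^{1/(256(2m+4)⁴)}`.  Proof = g6's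
`torusE_prod_indicator_largeField_le_of_uniformKernelBound` with the TRUE support `b^k y + [0,4b^k)⁴` of the indicator
(`isCylinder_indicator_largeFieldEvent_local`, `localBox_window`) fed to the peeling engine; no reflection positivity, no divisibility.
HONEST FRAMING: a reduction; (UCR_k) is the open one-box estimate. [folklore] -/
theorem torusE_prod_indicator_largeField_le_of_uniformKernelBound_smallCollar (β : ℝ) (𝔟 : BlockSize) (m : ℕ) (hm : 3 ≤ m)
    (ε : ℝ) (k L : ℕ) (hfit : (2 * m + 1) * 𝔟.b ^ k + 3 ≤ 2 * L + 1) (w : ℝ) (hw0 : 0 ≤ w) (hw1 : w ≤ 1)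
    (hUCR : ∀ (y : Fin 4 → ℤ) (μ ν : Fin 4) (h : μ < ν) (η : LGConfig 4 (Matrix.specialUnitaryGroup (Fin N) ℂ)),
      kerE (Matrix.specialUnitaryGroup (Fin N) ℂ) r β (fun i => (𝔟.b : ℤ) ^ k * (y i - m)) ((2 * m + 1) * 𝔟.b ^ k) η
        ((largeFieldEvent (N := N) 𝔟 ε ⟨k, y, μ, ν, h⟩).indicator fun _ => (1 : ℝ)) ≤ w)
    (o : Fin 4 → ℤ) (A : Finset Polymer) (hA : ∀ γ ∈ A, γ.k = k)
    (hwin : ∀ γ ∈ A, ∀ c, o c ≤ anchor 𝔟 γ c ∧ anchor 𝔟 γ c + (𝔟.b : ℤ) ^ k ≤ o c + (2 * L + 1)) :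
    torusE (Matrix.specialUnitaryGroup (Fin N) ℂ) r β L (fun U => ∏ γ ∈ A,
        (largeFieldEvent (N := N) 𝔟 ε γ).indicator (fun _ => (1 : ℝ)) U) ≤
      ∏ _γ ∈ A, w ^ ((1 : ℝ) / (256 * (2 * m + 4) ^ 4)) := by
  classical
  haveI := isProbabilityMeasure_wilsonMeasure (d := 4) (L := 2 * L + 1) r.ρ r.continuous β
  obtain ⟨A', hA'A, hcard, lo, hlo, hdisj⟩ := exists_windowDisjoint_subfamily 𝔟 m k L hfit o A hA hwin
  set E : Polymer → Set (LGConfig 4 (Matrix.specialUnitaryGroup (Fin N) ℂ)) := fun γ => largeFieldEvent (N := N) 𝔟 ε γ with hEdef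
  -- drop the other members
  have hmono := torusE_prod_indicator_anti' r β L E (fun γ => measurableSet_largeFieldEvent (N := N) 𝔟 ε γ) hA'A
  -- peel the colour class, with the TRUE supports of the indicators
  have hpeel : torusE (Matrix.specialUnitaryGroup (Fin N) ℂ) r β L (fun U => ∏ γ ∈ A', (E γ).indicator (fun _ => (1 : ℝ)) U) ≤
      ∏ _γ ∈ A', w := by
    refine torusE_prod_le_prod_of_kerE_le (Matrix.specialUnitaryGroup (Fin N) ℂ) r β L lo A'
      (fun γ i => (𝔟.b : ℤ) ^ k * (γ.y i - m)) (fun _ => (2 * m + 1) * 𝔟.b ^ k) hlo hdisj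
      (fun γ => (E γ).indicator fun _ => (1 : ℝ)) (fun γ _ => measurable_const.indicator (measurableSet_largeFieldEvent (N := N) 𝔟 ε γ))
      (fun γ _ U => ⟨Set.indicator_nonneg (fun _ _ => zero_le_one) _,
        Set.indicator_apply_le' (fun _ => le_rfl) (fun _ => zero_le_one)⟩)
      (fun γ => (Fintype.piFinset fun i => Finset.Ico ((𝔟.b : ℤ) ^ γ.k * γ.y i)
        ((𝔟.b : ℤ) ^ γ.k * γ.y i + 4 * (𝔟.b : ℤ) ^ γ.k)) ×ˢ (Finset.univ : Finset (Fin 4)))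
      (fun γ _ => isCylinder_indicator_largeFieldEvent_local (N := N) 𝔟 ε γ) (fun γ hγ e he j => ?_) (fun _ => w) (fun _ _ => hw0)
      (fun γ hγ η => ?_)
    · have hk := hA γ (hA'A hγ)
      have h := localBox_window 𝔟 m hm γ.k γ.y he j
      rw [hk] at h
      exact h
    · have hk := hA γ (hA'A hγ)
      obtain ⟨kk, y, μ, ν, h⟩ := γ
      simp only at hk
      subst hk
      exact hUCR y μ ν h η
  rw [Finset.prod_const] at hpeel
  -- assembly: `w^{#A'} ≤ w^{#A/K}`
  set K : ℝ := 256 * (2 * (m : ℝ) + 4) ^ 4 with hKdef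
  have hK0 : 0 < K := by rw [hKdef]; positivity
  have hexp : (A.card : ℝ) / K ≤ (A'.card : ℝ) := by
    rw [div_le_iff₀ hK0]
    have : (A.card : ℝ) ≤ ((256 * (2 * m + 4) ^ 4 * A'.card : ℕ) : ℝ) := by exact_mod_cast hcard
    push_cast at this
    rw [hKdef]; linarith
  rw [Finset.prod_const]
  rw [show ((1 : ℝ) / (256 * (2 * m + 4) ^ 4)) = 1 / K by rw [hKdef]]
  rcases eq_or_lt_of_le hw0 with hw00 | hwpos
  · -- `w = 0`: either `A' = ∅` (then `A = ∅`) or the law is `≤ 0`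
    rw [← hw00] at hpeel ⊢
    rcases Nat.eq_zero_or_pos A'.card with h0 | hpos
    · have hA0 : A.card = 0 := by
        have := hcard; rw [h0, mul_zero] at this; exact Nat.le_zero.1 this
      rw [hA0, pow_zero]
      rw [Finset.card_eq_zero.1 hA0]
      simp only [Finset.prod_empty]
      unfold torusE
      rw [integral_const, smul_eq_mul, mul_one, probReal_univ]
    · rw [zero_pow (Nat.pos_iff_ne_zero.1 hpos)] at hpeel
      have hApos : A.card ≠ 0 := fun h => by
        have := Finset.card_le_card hA'A; rw [h] at this; omega
      rw [Real.zero_rpow (one_div_ne_zero hK0.ne'), zero_pow hApos]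
      exact hmono.trans hpeel
  · rw [← Real.rpow_natCast (w ^ (1 / K)) A.card, ← Real.rpow_mul hw0,
      show 1 / K * (A.card : ℝ) = (A.card : ℝ) / K by ring]
    refine hmono.trans (hpeel.trans ?_)
    rw [← Real.rpow_natCast w A'.card]
    exact Real.rpow_le_rpow_of_exponent_ge hwpos hw1 hexp

/-- **(UCR) ⇒ hWCL with the small collar**, in the letters of the window-cell-law binder of
`TemperedResponse.torusE_exp_two_mul_sum_influence_le_of_windowCellLaws` (p554392), guarded by the collar-cube fit: any odd block size `𝔟`,
collar `m ≥ 3`, thresholds `ε k`, weights `w k ∈ [0,1]` with (UCR_k) at every level `k ≥ 1`; then for every odd torus `2L+1` (`L ≥ 1`), every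
level `k ≥ 1` with `(2m+1)b^k + 3 ≤ 2L+1`, every window origin and every window family of level-`k` block-plaquettes:
`⟨∏_{γ∈A} 1_{largeFieldEvent 𝔟 (ε k) γ}∘lift⟩_{2L+1,β} ≤ ∏_{γ∈A} (w k)^{1/(256(2m+4)⁴)}`.  HONEST FRAMING: reduction only. [folklore] -/
theorem windowCellLaw_of_uniformConditionalRarity_smallCollar (β : ℝ) (𝔟 : BlockSize) (m : ℕ) (hm : 3 ≤ m) (ε w : ℕ → ℝ)
    (hw0 : ∀ k, 0 ≤ w k) (hw1 : ∀ k, w k ≤ 1)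
    (hUCR : ∀ k : ℕ, 1 ≤ k → ∀ (y : Fin 4 → ℤ) (μ ν : Fin 4) (h : μ < ν) (η : LGConfig 4 (Matrix.specialUnitaryGroup (Fin N) ℂ)),
      kerE (Matrix.specialUnitaryGroup (Fin N) ℂ) r β (fun i => (𝔟.b : ℤ) ^ k * (y i - m)) ((2 * m + 1) * 𝔟.b ^ k) η
        ((largeFieldEvent (N := N) 𝔟 (ε k) ⟨k, y, μ, ν, h⟩).indicator fun _ => (1 : ℝ)) ≤ w k) :
    ∀ L : ℕ, 1 ≤ L → ∀ k : ℕ, 1 ≤ k → (2 * m + 1) * 𝔟.b ^ k + 3 ≤ 2 * L + 1 → ∀ (o : Fin 4 → ℤ) (A : Finset Polymer),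
      (∀ γ ∈ A, γ.k = k) → (∀ γ ∈ A, ∀ c, o c ≤ anchor 𝔟 γ c ∧ anchor 𝔟 γ c + (𝔟.b : ℤ) ^ k ≤ o c + (2 * L + 1)) →
      torusE (Matrix.specialUnitaryGroup (Fin N) ℂ) r β L (fun U => ∏ γ ∈ A,
          (largeFieldEvent (N := N) 𝔟 (ε k) γ).indicator (fun _ => (1 : ℝ)) U) ≤
        ∏ _γ ∈ A, w k ^ ((1 : ℝ) / (256 * (2 * m + 4) ^ 4)) :=
  fun L _ k hk hfit o A hA hwin =>
    torusE_prod_indicator_largeField_le_of_uniformKernelBound_smallCollar r β 𝔟 m hm (ε k) k L hfit (w k) (hw0 k) (hw1 k)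
      (hUCR k hk) o A hA hwin

end Assembly

/-! ## §2 Doubled joint exponential moments of the influence functionals from (UCR), collar `3 ≤ m ≤ 7` -/

section UCR

variable {N : ℕ} [NeZero N]

/-- **DOUBLED JOINT EXPONENTIAL MOMENTS OF THE INFLUENCE FUNCTIONALS FROM (UCR), SMALL COLLAR.**  Fundamental Wilson state of `SU(N)` on the
odd torus `2L+1`, `β ≥ 1`; a REDUCED cube family (`|x i c| ≤ L`), pairwise cyclically `2R+4`-separated, `1 ≤ R`, `4R+8 ≤ L`; ANY odd block size
`𝔟`, collar `3 ≤ m ≤ 7`, thresholds `ε`, cutoff `kmax`; weights `w k ∈ [0,1]` with the ONE-BOX bound (UCR_k) at every level `k ≥ 1`: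
`∀ y μ<ν η, kerE^η_{(b^k(y−m),(2m+1)b^k)}(1_{largeFieldEvent 𝔟 (ε k) (k,y,μ,ν)}) ≤ w k`.  THEN, with the constants `K₀, D₁` of the proved level-`0`
law and `K = 256(2m+4)⁴`:  `⟨exp(2 Σ_{i∈T} influence 𝔟 ε kmax R (x i)∘lift)⟩_{2L+1,β} ≤ exp(2e²·1536·(δ₀ + Σ_{1≤k≤kmax} (w k)^{1/(16K)})·#T)`.
Proof = g6's `torusE_exp_two_mul_sum_influence_le_of_uniformConditionalRarity` with §1's small-collar window cell law (the collar cube fits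
by `collarCube_fits_of_mem_familyShell`, which uses only `m ≤ 7`).  No RP, no divisibility, every block size. [folklore] -/
theorem torusE_exp_two_mul_sum_influence_le_of_uniformConditionalRarity_smallCollar :
    ∃ K₀ : ℝ, ∃ D₁ : ℕ, ∀ (𝔟 : BlockSize) (m : ℕ), 3 ≤ m → m ≤ 7 → ∀ (ε : ℕ → ℝ) (kmax R L : ℕ) (β : ℝ), 1 ≤ β →
      ∀ {n : ℕ} (x : Fin n → (Fin 4 → ℤ)), 1 ≤ R → 4 * R + 8 ≤ L → (∀ i c, |x i c| ≤ (L : ℤ)) →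
      (∀ i j : Fin n, i ≠ j → ∃ k : Fin 4,
        (2 * (R : ℤ) + 4) ≤ |((((x i k - x j k : ℤ) : ZMod (2 * L + 1))).valMinAbs : ℤ)|) →
      ∀ (w : ℕ → ℝ), (∀ k, 0 ≤ w k) → (∀ k, w k ≤ 1) →
      (∀ k : ℕ, 1 ≤ k → ∀ (y : Fin 4 → ℤ) (μ ν : Fin 4) (h : μ < ν) (η : LGConfig 4 (Matrix.specialUnitaryGroup (Fin N) ℂ)),
        kerE (Matrix.specialUnitaryGroup (Fin N) ℂ) (fundamentalLatticeRep N) β (fun i => (𝔟.b : ℤ) ^ k * (y i - m)) ((2 * m + 1) * 𝔟.b ^ k) η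
          ((largeFieldEvent (N := N) 𝔟 (ε k) ⟨k, y, μ, ν, h⟩).indicator fun _ => (1 : ℝ)) ≤ w k) →
      ∀ T : Finset (Fin n),
        torusE (Matrix.specialUnitaryGroup (Fin N) ℂ) (fundamentalLatticeRep N) β L
            (fun U => Real.exp (((2 : ℕ) : ℝ) * ∑ i ∈ T, influence (N := N) 𝔟 ε kmax R (x i) U)) ≤
          Real.exp (2 * Real.exp (2 * 1) * (1536 * (Real.exp (-(β * ((N : ℝ) * ε 0)) / Fintype.card (Orient 4) +
            (K₀ + D₁ * Real.log β) / Fintype.card (Orient 4)) +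
            ∑ k ∈ (Finset.range (kmax + 1)).filter (fun k => 1 ≤ k), w k ^ ((1 : ℝ) / (16 * (256 * (2 * m + 4) ^ 4))))) * T.card) := by
  classical
  obtain ⟨K₀, D₁, hShell⟩ := torusE_exp_two_mul_sum_influence_le_of_shellWindowCellLaws (N := N)
  refine ⟨K₀, D₁, ?_⟩
  intro 𝔟 m hm hm7 ε kmax R L β hβ n x hR hRL hred hsep w hw0 hw1 hUCR T
  haveI := isProbabilityMeasure_wilsonMeasure (d := 4) (L := 2 * L + 1) (fundamentalLatticeRep N).ρ
    (fundamentalLatticeRep N).continuous β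
  set K : ℝ := 256 * (2 * (m : ℝ) + 4) ^ 4 with hKdef
  have hK0 : 0 < K := by rw [hKdef]; positivity
  -- weights `θ k = (w k)^{1/(16K)}`, activities `δ k = (w k)^{1/K}`
  set θ : ℕ → ℝ := fun k => w k ^ ((1 : ℝ) / (16 * K)) with hθdef
  set δ : ℕ → ℝ := fun k => w k ^ ((1 : ℝ) / K) with hδdef
  have hθ0 : ∀ k, 0 ≤ θ k := fun k => Real.rpow_nonneg (hw0 k) _
  have hθ1 : ∀ k, θ k ≤ 1 := fun k => Real.rpow_le_one (hw0 k) (hw1 k) (by positivity)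
  have hδ0 : ∀ k, 0 ≤ δ k := fun k => Real.rpow_nonneg (hw0 k) _
  have hδθ : ∀ k, δ k ≤ θ k ^ 16 := fun k => by
    simp only [hθdef, hδdef]
    rw [← Real.rpow_natCast (w k ^ ((1 : ℝ) / (16 * K))) 16, ← Real.rpow_mul (hw0 k),
      show (1 : ℝ) / (16 * K) * ((16 : ℕ) : ℝ) = 1 / K by field_simp; ring]
  have h := hShell 𝔟 ε kmax R L β hβ x hR hRL hred hsep θ δ hθ0 hθ1 hδ0 hδθ ?_ T
  · simpa only [hθdef, hKdef] using h
  -- the shell law from (UCR): the collar cube fits for shell polymers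
  intro k hk o A hA hwin
  have hAk : ∀ γ ∈ A, γ.k = k := fun γ hγ => (Finset.mem_filter.1 (hA hγ)).2
  rcases A.eq_empty_or_nonempty with hAe | ⟨γ₀, hγ₀⟩
  · subst hAe
    simp only [Finset.prod_empty]
    unfold torusE
    rw [integral_const, smul_eq_mul, mul_one, probReal_univ]
  have hfit : (2 * m + 1) * 𝔟.b ^ k + 3 ≤ 2 * L + 1 := by
    have h := collarCube_fits_of_mem_familyShell 𝔟 hm7 kmax R L hRL x (Finset.mem_filter.1 (hA hγ₀)).1
    rwa [hAk γ₀ hγ₀] at h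
  have hlaw := torusE_prod_indicator_largeField_le_of_uniformKernelBound_smallCollar (N := N) (fundamentalLatticeRep N) β 𝔟 m hm
    (ε k) k L hfit (w k) (hw0 k) (hw1 k) (hUCR k hk) o A hAk hwin
  simpa only [hδdef, hKdef] using hlaw

end UCR

end Summit.QuantumFields.YangMills.Cruxes.UVSeamRec.DLRPeeling

end
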